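/-
Copyright (c) 2026 the pub-hodgecm-mathlib formalisation cell (harness21).  Prover seat hodgecm-mathlib-K2Liu-p01 (g5): Track B «K2-LIT»,
#184♮ = hLiu418 = stmt-HodgeConjecture-24832, road `K2_Liu`, socket #41, ROAD Φ organ Φ8a (B) «modulus of `P_Δ(F_v)` on `N_Δ(F_v)`», brick 1.
-/
import Summits.HodgeConjecture.HodgeConjecture.Theorems.K2E5HaarCharProduct    -- ★ (K2E5-p19) `addEquivAddHaarChar_eq_prod_of_pi`, `…_eq_mul_of_prod` (modules multiply on products)
import Literature.MeasureTheory.Group.LocalFieldLinearJacobian                 -- ★ `addEquivAddHaarChar_continuousLinearEquiv`, `addEquivAddHaarChar_eq_of_semiconj`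
import Literature.NumberTheory.Automorphic.LocalRingUnitModulusProduct          -- ★ `distribHaarChar_eq_normAbs`
import Literature.NumberTheory.Automorphic.QuadraticLocalBaseChange             -- ★ `LocalRing`, `PlacesOver`
import HarnessLib

/-!
# Crux `HLiu418`, road `K2_Liu`, socket #41, organ Φ8a (B), brick 1: HAAR CHARACTERS OF MATRIX MULTIPLICATIONS OVER `E ⊗ F_v = Π_{w ∣ v} E_w` —
# `mod(X ↦ A X) = mod(X ↦ X A) = (Π_w ‖det A_w‖_w)ⁿ` on `M_n(E ⊗ F_v)`

Cell `hodgecm-mathlib`, crux item hLiu418 = `stmt-HodgeConjecture-24832`; squad K2 ∕ K2Liu; prover K2Liu-p01 (g5).  THEOREMS ONLY (no `def`,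
no `instance`, no notation, no named-fact hypothesis, no `sorry`); lane `--supports stmt-HodgeConjecture-24832` (count-neutral helper).
Consumer: brick 2 `K2LiuUnipDeltaConjugationModulus` (the module `|det_Δ p|_v^{n}` of `Ad(p)`, `p ∈ P_Δ(F_v)`, on `N_Δ(F_v) ≅ Skew_n(E ⊗ F_v)` by the
«square root» `M_n = Skew ⊕ δ·Skew`), which discharges `hmod` of ★ `K2LiuLocalIntertwiningProperty.isLocalSiegelSection_localIntertwining_of_modulus`.

THE MATHEMATICS ([WeilBNT1967, Ch. I §2: the module of an automorphism; Prop. 2 Cor. 3 `mod_V(L) = mod_K(det L)`; modules of products]).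
Mathlib's `addEquivAddHaarChar φ` is Weil's module of a bi-continuous additive automorphism `φ` (`μ(φ S) = χ(φ) μ(S)` for every regular Haar `μ`).
Modules multiply on finite products: ★ `K2E5HaarCharProduct.addEquivAddHaarChar_eq_prod_of_pi` (K2E5-p19, stated for ANY `Φ` acting componentwise).
* §1 (a topological commutative ring `R`; a non-archimedean local field `K`) the bi-continuous additive automorphisms `x ↦ A x`, `X ↦ A X`, `X ↦ X A`
  for `A ∈ GL_d(R)` (existence, def-free), and `χ(x ↦ A x on Kᵈ) = ‖det A‖_K` (★ `addEquivAddHaarChar_continuousLinearEquiv` + ★ `distribHaarChar_eq_normAbs`;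
  sibling of ★ `K2E5QuatLocalLeftMulModule.addEquivAddHaarChar_of_mulVec`, here in the `normAbs` currency of ★ `Weil1964.MatrixAddHaarModule`).
* §2 (`R = E ⊗ F_v = Π_{w ∣ v} E_w`, ★ `UnitaryGroup.LocalRing`, ANY quadratic `E ∕ F`, any rank) `χ(x ↦ A x on Rᵈ) = Π_w ‖(det A)_w‖_w` (transport
  `Rᵈ ≅ Π_w E_wᵈ` ★ `addEquivAddHaarChar_eq_of_semiconj`, ★ product lemma, §1) — the general-rank, general-`E∕F` twin of ★
  `K2E5QuatLocalLeftMulModule.addEquivAddHaarChar_of_mulVec_localRing` (`Fin 2`, CM).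
* §3 (`M = M_n(R)`) `χ(X ↦ A X) = (Π_w ‖(det A)_w‖_w)ⁿ` (columns) and `χ(X ↦ X A) = (Π_w ‖(det A)_w‖_w)ⁿ` (rows), ★ product lemma + §2.
HONEST LABEL.  Count-neutral helper; it retires nothing by itself: `HC_CM` is proved only modulo the 7 printed citations (2 remaining named inputs:
hLiu418 = `stmt-HodgeConjecture-24832`, h413 = `stmt-HodgeConjecture-24833`) until rung 0 closes.

## References
* [WeilBNT1967] A. Weil, *Basic Number Theory*, Grundlehren 144 (1967): Ch. I §2 (module of an automorphism; Prop. 2 Cor. 3; modules of products).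
* [Tate1950] J. Tate, *Fourier analysis in number fields and Hecke's zeta-functions* (1950): §2.2 Lemma 2.2.5 (`d(aξ) = |a| dξ`).
-/

set_option autoImplicit false
set_option linter.dupNamespace false -- the mandated namespace repeats `HodgeConjecture.HodgeConjecture`

noncomputable section

open MeasureTheory MeasureTheory.Measure Matrix Topology Set
open scoped NNReal ENNReal
open Literature.NumberTheory.GaloisRepresentations.IsNonarchimedeanLocalField
open Literature.NumberTheory.Automorphic Literature.NumberTheory.Automorphic.UnitaryGroup
open Literature.MeasureTheory.Group
open Summit.HodgeConjecture.HodgeConjecture.Cruxes.H413.K2E5HaarCharProduct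

namespace Summit.HodgeConjecture.HodgeConjecture.Cruxes.HLiu418.K2LiuLocalMatrixHaarChar

/-! ## §1 The automorphisms `x ↦ A x`, `X ↦ A X`, `X ↦ X A`; `χ(x ↦ A x) = ‖det A‖_K` on `Kᵈ` for a non-archimedean local field `K` -/

section TopRing

variable {R : Type*} [CommRing R] [TopologicalSpace R] [IsTopologicalRing R] {ι : Type*} [Fintype ι] [DecidableEq ι]

/-- `x ↦ A x` is a bi-continuous additive automorphism of `Rᵈ` for `A ∈ GL_d(R)` (`R` a topological commutative ring). [folklore] -/
theorem exists_continuousAddEquiv_mulVec (A : Matrix ι ι R) (hA : IsUnit A.det) :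
    ∃ L : (ι → R) ≃ₜ+ (ι → R), ∀ x, L x = A *ᵥ x := by
  refine ⟨⟨⟨⟨fun x => A *ᵥ x, fun x => A⁻¹ *ᵥ x, fun x => ?_, fun x => ?_⟩, fun x y => Matrix.mulVec_add _ _ _⟩,
    continuous_const.matrix_mulVec continuous_id, continuous_const.matrix_mulVec continuous_id⟩, fun x => rfl⟩
  · show A⁻¹ *ᵥ (A *ᵥ x) = x
    rw [Matrix.mulVec_mulVec, Matrix.nonsing_inv_mul _ hA, Matrix.one_mulVec]
  · show A *ᵥ (A⁻¹ *ᵥ x) = x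
    rw [Matrix.mulVec_mulVec, Matrix.mul_nonsing_inv _ hA, Matrix.one_mulVec]

/-- `X ↦ A X` is a bi-continuous additive automorphism of `M_d(R)` for `A ∈ GL_d(R)`. [folklore] -/
theorem exists_continuousAddEquiv_mulLeft (A : Matrix ι ι R) (hA : IsUnit A.det) :
    ∃ L : Matrix ι ι R ≃ₜ+ Matrix ι ι R, ∀ X, L X = A * X := by
  refine ⟨⟨⟨⟨fun X => A * X, fun X => A⁻¹ * X, fun X => ?_, fun X => ?_⟩, fun X Y => Matrix.mul_add _ _ _⟩,
    continuous_const.matrix_mul continuous_id, continuous_const.matrix_mul continuous_id⟩, fun X => rfl⟩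
  · show A⁻¹ * (A * X) = X
    rw [← Matrix.mul_assoc, Matrix.nonsing_inv_mul _ hA, Matrix.one_mul]
  · show A * (A⁻¹ * X) = X
    rw [← Matrix.mul_assoc, Matrix.mul_nonsing_inv _ hA, Matrix.one_mul]

/-- `X ↦ X A` is a bi-continuous additive automorphism of `M_d(R)` for `A ∈ GL_d(R)`. [folklore] -/
theorem exists_continuousAddEquiv_mulRight (A : Matrix ι ι R) (hA : IsUnit A.det) :
    ∃ L : Matrix ι ι R ≃ₜ+ Matrix ι ι R, ∀ X, L X = X * A := by
  refine ⟨⟨⟨⟨fun X => X * A, fun X => X * A⁻¹, fun X => ?_, fun X => ?_⟩, fun X Y => Matrix.add_mul _ _ _⟩,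
    continuous_id.matrix_mul continuous_const, continuous_id.matrix_mul continuous_const⟩, fun X => rfl⟩
  · show X * A * A⁻¹ = X
    rw [Matrix.mul_assoc, Matrix.mul_nonsing_inv _ hA, Matrix.mul_one]
  · show X * A⁻¹ * A = X
    rw [Matrix.mul_assoc, Matrix.nonsing_inv_mul _ hA, Matrix.mul_one]

end TopRing

section LocalField

variable {K : Type*} [Field K] [ValuativeRel K] [TopologicalSpace K] [IsNonarchimedeanLocalField K] [MeasurableSpace K] [BorelSpace K]
  [SecondCountableTopology K] {ι : Type*} [Fintype ι] [DecidableEq ι]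

/-- **`χ(x ↦ A x) = ‖det A‖_K`** on `Kᵈ` for a (second countable, locally compact) non-archimedean local field `K` and `A ∈ GL_d(K)` (★ `addEquivAddHaarChar_continuousLinearEquiv`:
`χ = mod_K(det)`; ★ `distribHaarChar_eq_normAbs`: `mod_K = ‖·‖_K`). [cite: WeilBNT1967, Ch. I §2, Prop. 2 Cor. 3] [cite: Tate1950, §2.2 Lemma 2.2.5] -/
theorem addEquivAddHaarChar_mulVec_eq_normAbs (A : Matrix ι ι K) (hA : IsUnit A.det) (L : (ι → K) ≃ₜ+ (ι → K))
    (hL : ∀ x, L x = A *ᵥ x) : addEquivAddHaarChar L = normAbs K A.det := by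
  letI := Matrix.invertibleOfIsUnitDet A hA
  set Lc : (ι → K) ≃L[K] (ι → K) := ContinuousLinearEquiv.mk (Matrix.toLinearEquiv' A inferInstance)
    (Matrix.toLinearEquiv' A inferInstance).toLinearMap.continuous_on_pi (Matrix.toLinearEquiv' A inferInstance).symm.toLinearMap.continuous_on_pi
    with hLc
  have hLcx : ∀ x, Lc x = A *ᵥ x := fun x => by
    rw [hLc]
    rfl
  have hLL : L = Lc.toContinuousAddEquiv := by
    refine ContinuousAddEquiv.ext fun x => ?_
    rw [hL x]
    exact (hLcx x).symm
  have hdet : ((LinearEquiv.det Lc.toLinearEquiv : Kˣ) : K) = A.det := by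
    have h : (Lc.toLinearEquiv : (ι → K) →ₗ[K] (ι → K)) = Matrix.toLin' A := by
      refine LinearMap.ext fun x => ?_
      rw [Matrix.toLin'_apply, ← hLcx x]
      rfl
    rw [LinearEquiv.coe_det, h, LinearMap.det_toLin']
  rw [hLL, addEquivAddHaarChar_continuousLinearEquiv Lc, distribHaarChar_eq_normAbs, hdet]

end LocalField

/-! ## §2 `χ(x ↦ A x) = Π_{w ∣ v} ‖(det A)_w‖_w` on `(E ⊗ F_v)ᵈ`, `E ⊗ F_v = Π_{w ∣ v} E_w` -/

section LocalRingSec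

open NumberField IsDedekindDomain

variable {F : Type} (E : Type) [Field F] [NumberField F] [Field E] [NumberField E] [Algebra F E] (v : HeightOneSpectrum (𝓞 F))
  {ι : Type*} [Fintype ι] [DecidableEq ι]

omit [NumberField F] [DecidableEq ι] in
/-- `(A x)_w = A_w x_w`: the `w`-component of a matrix–vector product over `Π_{w ∣ v} E_w`. [folklore] -/
theorem mulVec_apply_place (A : Matrix ι ι (LocalRing E v)) (x : ι → LocalRing E v) (i : ι) (w : PlacesOver E v) :
    (A *ᵥ x) i w = ((A.map (Pi.evalRingHom (fun w' : PlacesOver E v => w'.1.adicCompletion E) w)) *ᵥ fun j => x j w) i := by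
  simp only [Matrix.mulVec, dotProduct, Matrix.map_apply, Pi.evalRingHom_apply, Finset.sum_apply, Pi.mul_apply]

/-- **`χ(x ↦ A x) = Π_{w ∣ v} ‖(det A)_w‖_w` on `Rᵈ`, `R = E ⊗ F_v = Π_{w ∣ v} E_w`** and `A ∈ GL_d(R)`: transport along `Rᵈ ≅ Π_w E_wᵈ` (★
`addEquivAddHaarChar_eq_of_semiconj`), modules multiply on the product (★ `addEquivAddHaarChar_eq_prod_of_pi`), and each factor is `‖det A_w‖_w` (§1).
[cite: WeilBNT1967, Ch. I §2, Prop. 2 Cor. 3] -/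
theorem addEquivAddHaarChar_mulVec_localRing [MeasurableSpace (ι → LocalRing E v)] [BorelSpace (ι → LocalRing E v)]
    (A : Matrix ι ι (LocalRing E v)) (hA : IsUnit A.det) (L : (ι → LocalRing E v) ≃ₜ+ (ι → LocalRing E v)) (hL : ∀ x, L x = A *ᵥ x) :
    addEquivAddHaarChar L = ∏ w : PlacesOver E v, normAbs (w.1.adicCompletion E) (A.det w) := by
  haveI : ∀ w : PlacesOver E v, SecondCountableTopology (w.1.adicCompletion E) := fun w => secondCountableTopology_localField _
  letI : ∀ w : PlacesOver E v, MeasurableSpace (w.1.adicCompletion E) := fun w => borel _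
  haveI : ∀ w : PlacesOver E v, BorelSpace (w.1.adicCompletion E) := fun w => ⟨rfl⟩
  -- the per-place automorphisms `x_w ↦ A_w x_w`
  have hAw : ∀ w : PlacesOver E v, IsUnit (A.map (Pi.evalRingHom (fun w' : PlacesOver E v => w'.1.adicCompletion E) w)).det := fun w => by
    rw [← RingHom.mapMatrix_apply, ← RingHom.map_det]; exact hA.map _
  choose Lw hLw using fun w : PlacesOver E v => exists_continuousAddEquiv_mulVec _ (hAw w)
  -- the transport `Rᵈ ≅ Π_w E_wᵈ`
  set e : (ι → LocalRing E v) ≃ₜ+ (∀ w : PlacesOver E v, ι → w.1.adicCompletion E) :=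
    ⟨⟨⟨fun x w i => x i w, fun y i w => y w i, fun _ => rfl, fun _ => rfl⟩, fun _ _ => rfl⟩,
      continuous_pi fun w => continuous_pi fun i => (continuous_apply w).comp (continuous_apply i),
      continuous_pi fun i => continuous_pi fun w => (continuous_apply i).comp (continuous_apply w)⟩ with he
  have key := addEquivAddHaarChar_eq_of_semiconj e L ((e.symm.trans L).trans e) fun x => by
    simp only [ContinuousAddEquiv.trans_apply, ContinuousAddEquiv.symm_apply_apply]
  rw [key, addEquivAddHaarChar_eq_prod_of_pi ((e.symm.trans L).trans e) Lw fun y w => ?_]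
  · refine Finset.prod_congr rfl fun w _ => ?_
    rw [addEquivAddHaarChar_mulVec_eq_normAbs _ (hAw w) (Lw w) (hLw w), ← RingHom.mapMatrix_apply, ← RingHom.map_det]
    rfl
  · simp only [ContinuousAddEquiv.trans_apply, hLw, hL]
    funext i
    show (A *ᵥ fun j w' => y w' j) i w = _
    rw [mulVec_apply_place]

end LocalRingSec

/-! ## §3 `χ(X ↦ A X) = χ(X ↦ X A) = (Π_{w ∣ v} ‖(det A)_w‖_w)ⁿ` on `M_n(E ⊗ F_v)` -/

section MatrixSec

open NumberField IsDedekindDomain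

variable {F : Type} (E : Type) [Field F] [NumberField F] [Field E] [NumberField E] [Algebra F E] (v : HeightOneSpectrum (𝓞 F))
  {ι : Type*} [Fintype ι] [DecidableEq ι]

/-- **`χ(X ↦ A X) = (Π_{w ∣ v} ‖(det A)_w‖_w)ⁿ` on `M_n(R)`, `R = E ⊗ F_v`**, `A ∈ GL_n(R)`: `X ↦ A X` acts column by column (`M_n(R) ≅ (Rⁿ)ⁿ`), so its
module is the `n`-th power of the module of `x ↦ A x` on `Rⁿ` (★ `addEquivAddHaarChar_eq_prod_of_pi`, §2). [cite: WeilBNT1967, Ch. I §2, Prop. 2 Cor. 3] -/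
theorem addEquivAddHaarChar_matrix_mulLeft [MeasurableSpace (Matrix ι ι (LocalRing E v))] [BorelSpace (Matrix ι ι (LocalRing E v))]
    [LocallyCompactSpace (Matrix ι ι (LocalRing E v))]
    (A : Matrix ι ι (LocalRing E v)) (hA : IsUnit A.det) (L : Matrix ι ι (LocalRing E v) ≃ₜ+ Matrix ι ι (LocalRing E v))
    (hL : ∀ X, L X = A * X) :
    addEquivAddHaarChar L = (∏ w : PlacesOver E v, normAbs (w.1.adicCompletion E) (A.det w)) ^ Fintype.card ι := by
  haveI : ∀ w : PlacesOver E v, SecondCountableTopology (w.1.adicCompletion E) := fun w => secondCountableTopology_localField _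
  letI : MeasurableSpace (ι → LocalRing E v) := borel _
  haveI : BorelSpace (ι → LocalRing E v) := ⟨rfl⟩
  obtain ⟨Lv, hLv⟩ := exists_continuousAddEquiv_mulVec A hA
  -- columns: `M_n(R) ≅ (ι → Rⁿ)`, `X ↦ (j ↦ X^{(j)})`
  set e : Matrix ι ι (LocalRing E v) ≃ₜ+ (ι → (ι → LocalRing E v)) :=
    ⟨⟨⟨fun X j i => X i j, fun y => Matrix.of fun i j => y j i, fun _ => rfl, fun _ => rfl⟩, fun _ _ => rfl⟩,
      continuous_pi fun j => continuous_pi fun i => continuous_id.matrix_elem i j,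
      continuous_matrix fun i j => (continuous_apply i).comp (continuous_apply j)⟩ with he
  have key := addEquivAddHaarChar_eq_of_semiconj e L ((e.symm.trans L).trans e) fun X => by
    simp only [ContinuousAddEquiv.trans_apply, ContinuousAddEquiv.symm_apply_apply]
  rw [key, addEquivAddHaarChar_eq_prod_of_pi ((e.symm.trans L).trans e) (fun _ => Lv) fun y j => ?_]
  · rw [Finset.prod_const, Finset.card_univ, addEquivAddHaarChar_mulVec_localRing E v A hA Lv hLv]
  · simp only [ContinuousAddEquiv.trans_apply, hLv, hL]
    funext i
    show (A * Matrix.of fun i' j' => y j' i') i j = (A *ᵥ y j) i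
    simp only [Matrix.mul_apply, Matrix.of_apply, Matrix.mulVec, dotProduct]

/-- **`χ(X ↦ X A) = (Π_{w ∣ v} ‖(det A)_w‖_w)ⁿ` on `M_n(R)`, `R = E ⊗ F_v`**, `A ∈ GL_n(R)`: `X ↦ X A` acts row by row by `x ↦ Aᵀ x` (`M_n(R) ≅ (Rⁿ)ⁿ`),
and `det Aᵀ = det A` (★ `addEquivAddHaarChar_eq_prod_of_pi`, §2). [cite: WeilBNT1967, Ch. I §2, Prop. 2 Cor. 3] -/
theorem addEquivAddHaarChar_matrix_mulRight [MeasurableSpace (Matrix ι ι (LocalRing E v))] [BorelSpace (Matrix ι ι (LocalRing E v))]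
    [LocallyCompactSpace (Matrix ι ι (LocalRing E v))]
    (A : Matrix ι ι (LocalRing E v)) (hA : IsUnit A.det) (L : Matrix ι ι (LocalRing E v) ≃ₜ+ Matrix ι ι (LocalRing E v))
    (hL : ∀ X, L X = X * A) :
    addEquivAddHaarChar L = (∏ w : PlacesOver E v, normAbs (w.1.adicCompletion E) (A.det w)) ^ Fintype.card ι := by
  haveI : ∀ w : PlacesOver E v, SecondCountableTopology (w.1.adicCompletion E) := fun w => secondCountableTopology_localField _
  letI : MeasurableSpace (ι → LocalRing E v) := borel _
  haveI : BorelSpace (ι → LocalRing E v) := ⟨rfl⟩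
  have hAt : IsUnit Aᵀ.det := by rwa [Matrix.det_transpose]
  obtain ⟨Lv, hLv⟩ := exists_continuousAddEquiv_mulVec Aᵀ hAt
  -- rows: `M_n(R) ≅ (ι → Rⁿ)`, `X ↦ (i ↦ X_{(i)})`
  set e : Matrix ι ι (LocalRing E v) ≃ₜ+ (ι → (ι → LocalRing E v)) :=
    ⟨⟨⟨fun X i j => X i j, fun y => Matrix.of fun i j => y i j, fun _ => rfl, fun _ => rfl⟩, fun _ _ => rfl⟩,
      continuous_pi fun i => continuous_pi fun j => continuous_id.matrix_elem i j,
      continuous_matrix fun i j => (continuous_apply j).comp (continuous_apply i)⟩ with he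
  have key := addEquivAddHaarChar_eq_of_semiconj e L ((e.symm.trans L).trans e) fun X => by
    simp only [ContinuousAddEquiv.trans_apply, ContinuousAddEquiv.symm_apply_apply]
  rw [key, addEquivAddHaarChar_eq_prod_of_pi ((e.symm.trans L).trans e) (fun _ => Lv) fun y i => ?_]
  · rw [Finset.prod_const, Finset.card_univ, addEquivAddHaarChar_mulVec_localRing E v Aᵀ hAt Lv hLv, Matrix.det_transpose]
  · simp only [ContinuousAddEquiv.trans_apply, hLv, hL]
    funext k
    show ((Matrix.of fun i' j' => y i' j') * A) i k = (Aᵀ *ᵥ y i) k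
    simp only [Matrix.mul_apply, Matrix.of_apply, Matrix.mulVec, dotProduct, Matrix.transpose_apply]
    exact Finset.sum_congr rfl fun j _ => mul_comm _ _

end MatrixSec

end Summit.HodgeConjecture.HodgeConjecture.Cruxes.HLiu418.K2LiuLocalMatrixHaarChar

end
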